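import Summits.Ventures.YMGap.RobustBall.WilsonStringTension
import Summits.Ventures.YMGap.Thresholds.StarInfiniteVolume
import HarnessLib

/-!
# Venture YMGap, track ROBUST-BALL — one state, massive and confining: `SU(2)`, `d = 4`, `0 < β_W ≤ 9/25`

HONEST FRAMING. WHAT THIS IS: a venture file (cell `pub-ymgap`, seat rb-p2 g3) joining two TREE THEOREMS
about Wilson's `SU(2)` lattice gauge theory in `d = 4` (tree coupling `β_W/2`): track (a)'s UNIQUE
thermodynamic limit with exponential clustering at every `0 ≤ β_W ≤ 9/25`
(`DSWindowZd.su2_hasUniqueInfiniteVolumeLimit_le_9_25`, `…_hasUniqueGibbsMeasure_le_9_25`,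
`…_massGapAt_le_9_100`, conjunct T9 of the venture statement) and this seat's CONFINEMENT of every
limit state at `0 < β_W < 2/3` (`WilsonStringTension.su2_isConfining_dim4`). WHAT IT IS NOT: a lattice
strong-coupling statement; nothing about the continuum limit, a spectral / transfer-matrix gap, or a
Clay-sense mass gap.

RESULT (`su2_oneState_massive_confining`): for every `0 < β_W ≤ 9/25` there is ONE probability measure `μ`
on `SU(2)^{edges(ℤ⁴)}` such that (i) the full sequence of torus Wilson states converges to `μ`
(`IsInfiniteVolumeLimit`) and `μ` is the only subsequential limit point; (ii) `μ` is the only DLR state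
of the Wilson specification; (iii) `MassGapAt 4 2 (β_W/4)` (uniqueness + Shen–Zhu–Zhu exponential
clustering of Lipschitz cylinder observables); (iv) `μ` CONFINES: its fundamental string tension exists and
is strictly positive (`IsConfining`). [folklore]
-/

noncomputable section

open MeasureTheory
open Literature.Probability.LatticeModels
open Literature.MathematicalPhysics.QuantumLattice Literature.MathematicalPhysics.QuantumFieldTheory

namespace Summit.Ventures.YMGap.RobustBall

namespace WilsonStringTension

/-- **ONE STATE, MASSIVE AND CONFINING** (`SU(2)`, `d = 4`, every `0 < β_W ≤ 9/25`, tree coupling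
`β_W/2`): the torus Wilson states converge to a single infinite-volume state `μ`, which is the unique
DLR state of the Wilson specification, clusters exponentially (`MassGapAt 4 2 (β_W/4)`), and confines
(`IsConfining μ χ₂`: the fundamental string tension exists and is `> 0`). [folklore] -/
theorem su2_oneState_massive_confining {βW : ℝ} (hβ : 0 < βW) (hle : βW ≤ 9 / 25) :
    ∃ μ : Measure (LGConfig 4 (SUN 2)),
      Literature.MathematicalPhysics.QuantumLattice.IsInfiniteVolumeLimit (fundamentalRep (Fin 2)) (βW / 2) μ ∧
      infiniteVolumeLimitPoints (d := 4) (fundamentalRep (Fin 2)) (βW / 2) = {μ} ∧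
      ymGibbsMeasures (d := 4) (fundamentalRep (Fin 2)) (βW / 2) = {μ} ∧
      MassGapAt 4 2 (βW / 4) ∧
      IsConfining μ (fun g => normalisedCharacter 2 (fundamentalRep (Fin 2) g)) := by
  obtain ⟨μ, hlim, hpts⟩ := DSWindowZd.su2_hasUniqueInfiniteVolumeLimit_le_9_25 hβ.le hle
  have hμ : μ ∈ infiniteVolumeLimitPoints (d := 4) (fundamentalRep (Fin 2)) (βW / 2) := by
    rw [hpts]; exact Set.mem_singleton μ
  have hG : μ ∈ ymGibbsMeasures (d := 4) (fundamentalRep (Fin 2)) (βW / 2) :=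
    mem_ymGibbsMeasures_of_mem_infiniteVolumeLimitPoints_holds (fundamentalRep (Fin 2))
      (continuous_fundamentalRep (Fin 2)) hμ
  have huniq := DSWindowZd.su2_hasUniqueGibbsMeasure_le_9_25 hβ.le hle
  have e : (((2 : ℕ) : ℝ)) * (βW / 4) = βW / 2 := by push_cast; ring
  rw [e] at huniq
  have hGibbs : ymGibbsMeasures (d := 4) (fundamentalRep (Fin 2)) (βW / 2) = {μ} := by
    refine Set.eq_singleton_iff_unique_mem.2 ⟨hG, fun ν hν => huniq.1 hν hG⟩
  refine ⟨μ, hlim, hpts, hGibbs, ?_, su2_isConfining_dim4 hβ (by linarith) hμ⟩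
  exact DSWindowZd.su2_massGapAt_le_9_100 (β := βW / 4) (by linarith) (by linarith)

end WilsonStringTension

end Summit.Ventures.YMGap.RobustBall
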